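import Mathlib
import Summits.KontsevichZagierPeriods.Zeta5Search.CollinearityCriterionProof
import Summits.KontsevichZagierPeriods.Zeta5Search.CollinearityGuardProof
import Summits.KontsevichZagierPeriods.Zeta5Search.SecondOrderLive
import Summits.KontsevichZagierPeriods.Zeta5Search.RhoResidueIdentitiesProof
import HarnessLib

/-!
# ζ(5) search — TRACK «DENOM-LAW» D1: the RAISE-LINE rung — when the deep classes are single raises of one palindromic type
# (and/or its odd-centre class), every deep orbit vector is the SAME vector, and the collinearity criterion gives `casLB + 1`

Cell `pub-zeta5` (HONEST FRAMING: systematic search; no irrationality claim unless certified), seat denom-prover-d1 generation 9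
(`HOME/denom-law/prover-d1/ATTEMPT-9.md`).  `p`-adic valuations of the cell's own explicit rationals (the contiguity Casoratian
`Cas_j(b) = W(b+e_j)V(b) − W(b)V(b+e_j)` of the Brown–Zudilin dual coefficients); nothing about ζ(5); no γ moves; records in print UNMOVED.

THE GAP IT FILLS.  On the three digit types a=0 λ=(3)ᴰ, a=1 (2)ᴰ, a=3 ∅ of the conjecture node `DenomLaw.RuleR2Casoratian` the chamber
«centre class CO-DOMINANT with non-centre orbits at the minimal exponent `−N`, `N` odd» (48 of 1,190 exact cells at `p = 11, 13`, all of
them satisfying R2 = `casLB + 1`) is reached by NO landed rung: census g17's structural guards `ccGuard` / `ccGuardT` count `k = 2` orbit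
KEYS (centre key ≠ pair key) and the affine branch is out of its moment range, `rungJGuard` (Lemma D) fails on the two types, `rungBGuard`,
`rungYGuard` fail, and `casLB = casLBPlus = casLBK = casLBKPlus` (ATTEMPT-9 §2, kernel evaluations).  The mechanism: in that chamber every
non-centre deep class `x` has the type LIST of a SINGLE RAISE (`SecondOrder.isRaise`) of the centre's palindromic type `T`, its conjugate the
reversed raise, so by the tree's RAISE LEMMA (`SecondOrder.live_pair`: `ŵ_x + ŵ_x̄ = τ_W(T)`, `v̂_x + v̂_x̄ = τ_V(T)`, also for the odd-centre class
of type `T` itself) and the third rho residue identity (`ĉ_x = [E_x = −3] − ŵ_x` for `E_x ≤ −3`, `rhoResidueIdentities_holds`) ALL deep orbit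
vectors `(P_K(x), P_V(x))` are EQUAL to `(2[N = 3] − τ_W(T), τ_V(T))` — one line through the origin of `𝔽_p²` whatever the key count — and the
PROVED `collinearityCriterion_holds` (through-origin case, no moment range) yields `casLB b p + 1 ≤ v_p(Cas_j(b))`.

* `cHat_add_wHat` — `ĉ_x + ŵ_x = [E_x = −3]` (`E_x ≤ −3`).
* `orbit_eq_of_raiseLine` — under the RAISE-LINE hypothesis (every deep class is multipole and its type list is a single raise of the
  palindromic list `T`, or it is the odd-centre class with list `T`; `N` odd) every deep orbit vector equals `(2[N=3] − τ_W(T), τ_V(T))`.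
* `casLB_succ_le_of_raiseLine` — the rung: regime H0 at odd depth `N ≥ 3` + raise-line ⟹ `casLB + 1 ≤ v_p(Cas_j(b))`.
(The same as ONE decidable Boolean guard of `(b, p, N, T)` — census-ladder form — is the sequel file `RaiseLineGuard`.)
This is the first-order sibling of THEOREM A‴ (`SecondOrder.LawA3`): there the raise pairs and the odd-centre class sit one unit ABOVE a deep
palindromic type; here they ARE the deep classes.  Nothing here bears on irrationality.
-/

noncomputable section

open Finset

namespace Summit.KontsevichZagierPeriods.Zeta5Search.DenomLaw.RaiseLine

open Summit.KontsevichZagierPeriods.Zeta5Search.CasoratianValuation (InPolytope shift casoratian)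
open Summit.KontsevichZagierPeriods.Zeta5Search.WedgeDictionary (dOf)
open Summit.KontsevichZagierPeriods.Zeta5Search.ClusterValuation
open Summit.KontsevichZagierPeriods.Zeta5Search.SecondOrder (classTypeList isRaise tTop tList typeTauW typeTauV live_pair)

variable {p : ℕ} [hp : Fact p.Prime]

/-! ## §1  `ĉ + ŵ` on a class of exponent `≤ −3` -/

/-- **`ĉ_x + ŵ_x = [E_x = −3]`** for a class with `E_x ≤ −3`: the third rho residue identity
`Σ_q (ρ_{q,3} + 2ℓ_q ρ_{q,2} + ℓ_q² ρ_{q,1}) = [E_x = −3]` read through the definitions of `cHat` and `wHat`. -/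
theorem cHat_add_wHat (b : ℕ → ℤ) (hb : InPolytope b) (hp5 : 5 ≤ p) (hwin : (b 0 + 2 : ℤ) < (p : ℤ) ^ 2) {x : ℕ}
    (hx : x < p) (hE : classExp b p x ≤ -3) :
    cHat b p x + wHat b p x = if classExp b p x = -3 then 1 else 0 := by
  obtain ⟨-, -, h3⟩ := rhoResidueIdentities_holds b p x hb hp.out hp5 hwin hx
  rw [← h3 hE]
  unfold cHat wHat
  rw [← sum_add_distrib]
  refine sum_congr rfl fun q _ => ?_
  split_ifs <;> ring

/-! ## §2  The raise-line hypothesis makes all deep orbit vectors equal -/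

section RaiseLine

variable (b : ℕ → ℤ) (hb : InPolytope b) (hp5 : 5 ≤ p) (hpb : (p : ℤ) ≤ b 0) (hwin : (b 0 + 2 : ℤ) < (p : ℤ) ^ 2)
  {N : ℕ} (hN3 : 3 ≤ N) (hodd : N % 2 = 1) {T : List ℤ} (hT : T.reverse = T)
  (hdeep : ∀ x ∈ deepClasses b p N, 2 ≤ classPoleCount b p x ∧
    (isRaise T (classTypeList b p x) = true ∨ (¬ (2 : ℤ) ∣ b 0 ∧ CentreIn b p x ∧ classTypeList b p x = T)))
include hb hp5 hpb hwin hN3 hodd hT hdeep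

/-- **Equal orbit vectors.**  Under the raise-line hypothesis at odd depth `N ≥ 3`, every deep class `x` has
`P_K(x) = 2[N = 3] − τ_W(T)` and `P_V(x) = τ_V(T)`. -/
theorem orbit_eq_of_raiseLine {x : ℕ} (hx : x ∈ deepClasses b p N) :
    orbitK b p N x = 2 * (if N = 3 then (1 : ℚ) else 0) - typeTauW (tTop T) (tList T) ∧
      orbitV b p N x = typeTauV (tTop T) (tList T) := by
  have h0 : 0 ≤ b 0 := hb.1.1
  have hpn : p ≤ (b 0).toNat := by have := hb.1.1; omega
  obtain ⟨hxr, hEx⟩ := mem_filter.1 hx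
  have hxp : x < p := mem_range.1 hxr
  obtain ⟨hpole2, h4⟩ := hdeep x hx
  have hneg : classExp b p x < 0 := by omega
  have hE3 : classExp b p x ≤ -3 := by omega
  -- the conjugate class is deep as well
  have hxc : conjClass b p x ∈ deepClasses b p N := conjClass_mem_deepClasses b hb hpn hx
  obtain ⟨hxcr, hExc⟩ := mem_filter.1 hxc
  have hxcp : conjClass b p x < p := mem_range.1 hxcr
  obtain ⟨hpole2c, -⟩ := hdeep _ hxc
  -- the raise lemma (exact identities of the first digits of the pair)
  obtain ⟨hw, hv⟩ := live_pair b hb hpb hT hxp (by omega) hneg h4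
  -- `ĉ = [N = 3] − ŵ` on both classes
  have hind : (if classExp b p x = -3 then (1 : ℚ) else 0) = if N = 3 then 1 else 0 := by
    by_cases h3 : N = 3
    · rw [if_pos (by omega), if_pos h3]
    · rw [if_neg (by omega), if_neg h3]
  have hindc : (if classExp b p (conjClass b p x) = -3 then (1 : ℚ) else 0) = if N = 3 then 1 else 0 := by
    by_cases h3 : N = 3
    · rw [if_pos (by omega), if_pos h3]
    · rw [if_neg (by omega), if_neg h3]
  have hc1 : cHat b p x = (if N = 3 then (1 : ℚ) else 0) - wHat b p x := by
    have := cHat_add_wHat b hb hp5 hwin hxp hE3; rw [hind] at this; linarith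
  have hc2 : cHat b p (conjClass b p x) = (if N = 3 then (1 : ℚ) else 0) - wHat b p (conjClass b p x) := by
    have := cHat_add_wHat b hb hp5 hwin hxcp (by omega); rw [hindc] at this; linarith
  have hs1 : sigmaK b p x = cHat b p x := by unfold sigmaK; rw [if_pos hpole2]
  have hs2 : sigmaK b p (conjClass b p x) = cHat b p (conjClass b p x) := by unfold sigmaK; rw [if_pos hpole2c]
  have hsgn : (-1 : ℚ) ^ (N + 1) = 1 := Even.neg_one_pow (Nat.odd_iff.2 hodd).add_one
  by_cases hcen : CentreIn b p x
  · -- self-conjugate: `x̄ = x`, the pair identity reads `2ŵ_x = τ_W`, `2v̂_x = τ_V`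
    have hcc : conjClass b p x = x := (centreIn_iff_conjClass_eq b hpn hxp).1 hcen
    rw [hcc] at hw hv
    unfold orbitK orbitV
    rw [if_pos hcen, if_pos hcen, hs1, hc1]
    constructor <;> linarith
  · unfold orbitK orbitV
    rw [if_neg hcen, if_neg hcen, hs1, hs2, hc1, hc2, hsgn]
    constructor <;> linarith

/-- **THE RAISE-LINE RUNG.**  Window prime (`5 ≤ p ≤ b₀`, `p ≤ d`, `b₀ + 2 < p²`), regime H0 at an ODD depth `N ≥ 3` attained by a
multipole class, and the raise-line hypothesis (every deep class is multipole with type list a single raise of the palindromic list `T`, or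
is the odd-centre class with list `T`) ⟹ `casLB b p + 1 ≤ v_p(Cas_j(b))`.  Proof: all deep orbit vectors are equal
(`orbit_eq_of_raiseLine`), hence on one line through the origin of `𝔽_p²`; `collinearityCriterion_holds`. -/
theorem casLB_succ_le_of_raiseLine {j : ℕ} (hb' : InPolytope (shift b j)) (hj1 : 1 ≤ j) (hj7 : j ≤ 7)
    (hpd : (p : ℤ) ≤ dOf b) (hH0 : ∀ x, x < p → -(N : ℤ) ≤ classExp b p x)
    (hM : ∃ x ∈ multipoleClasses b p, classExp b p x = -(N : ℤ)) (hcas : casoratian b j ≠ 0) :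
    casLB b p + 1 ≤ padicValRat p (casoratian b j) := by
  classical
  have hprime := hp.out
  have hone : ¬ ((p : ℤ) ∣ 1) := fun h => by have := Int.le_of_dvd one_pos h; omega
  have ev : ∀ z : ZMod p, (((z.val : ℕ) : ℤ) : ZMod p) = z := fun z => by rw [Int.cast_natCast, ZMod.natCast_zmod_val]
  -- a deep class `x₀`
  obtain ⟨x₀, hx₀M, hx₀E⟩ := hM
  have hx₀D : x₀ ∈ deepClasses b p N := mem_filter.2 ⟨(mem_filter.1 hx₀M).1, hx₀E⟩
  -- all deep orbit vectors equal that of `x₀`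
  have hall : ∀ x ∈ deepClasses b p N, orbitK b p N x = orbitK b p N x₀ ∧ orbitV b p N x = orbitV b p N x₀ := by
    intro x hx
    obtain ⟨hk, hv⟩ := orbit_eq_of_raiseLine b hb hp5 hpb hwin hN3 hodd hT hdeep hx
    obtain ⟨hk₀, hv₀⟩ := orbit_eq_of_raiseLine b hb hp5 hpb hwin hN3 hodd hT hdeep hx₀D
    exact ⟨hk.trans hk₀.symm, hv.trans hv₀.symm⟩
  -- the line through the origin
  have hline : ∃ a c e : ℤ, ¬ ((p : ℤ) ∣ a ∧ (p : ℤ) ∣ c) ∧ (e = 0 ∨ ((N : ℤ) - 1) * p + 2 ≤ 2 * dOf b + 3) ∧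
      ∀ x ∈ deepClasses b p N, pCong p (a * orbitK b p N x + c * orbitV b p N x + e) = true := by
    by_cases hz : ((orbitK b p N x₀ : ℚ) : ZMod p) = 0 ∧ ((orbitV b p N x₀ : ℚ) : ZMod p) = 0
    · refine ⟨1, 0, 0, fun h => hone h.1, Or.inl rfl, fun x hxD => ?_⟩
      have h := pCong_line_of_cast b hb hp5 hwin 1 0 0 x (N := N) (by
        rw [(hall x hxD).1, (hall x hxD).2, hz.1]; simp)
      simpa using h
    · refine ⟨((((orbitV b p N x₀ : ℚ) : ZMod p).val : ℕ) : ℤ), -((((orbitK b p N x₀ : ℚ) : ZMod p).val : ℕ) : ℤ), 0,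
        fun h => hz ?_, Or.inl rfl, fun x hxD => ?_⟩
      · obtain ⟨h1, h2⟩ := h
        refine ⟨?_, ?_⟩
        · rw [← ev ((orbitK b p N x₀ : ℚ) : ZMod p)]; exact (ZMod.intCast_zmod_eq_zero_iff_dvd _ _).2 ((dvd_neg).1 h2)
        · rw [← ev ((orbitV b p N x₀ : ℚ) : ZMod p)]; exact (ZMod.intCast_zmod_eq_zero_iff_dvd _ _).2 h1
      · have h := pCong_line_of_cast b hb hp5 hwin ((((orbitV b p N x₀ : ℚ) : ZMod p).val : ℕ) : ℤ)
          (-((((orbitK b p N x₀ : ℚ) : ZMod p).val : ℕ) : ℤ)) 0 x (N := N) (by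
          rw [(hall x hxD).1, (hall x hxD).2, Int.cast_neg, ev, ev, Int.cast_zero, add_zero]; ring)
        simpa using h
  exact collinearityCriterion_holds b p j N hb hb' hj1 hj7 hprime hp5 hpb hpd hwin hN3 hH0 ⟨x₀, hx₀M, hx₀E⟩ hline hcas

end RaiseLine

end Summit.KontsevichZagierPeriods.Zeta5Search.DenomLaw.RaiseLine

end
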